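import Mathlib.Algebra.BigOperators.Group.Finset.Basic
import Mathlib.Algebra.Group.Action.Defs
import Mathlib.Algebra.Order.BigOperators.Group.Finset
import Mathlib.Data.Finset.Prod
import Mathlib.Order.UpperLower.Basic
import Mathlib.Tactic.Ring
import HarnessLib

/-!
# Discrete tomography in `ℕ³`: plane-sum marginals, coordinate sums, discrete simplices,
layers and pyramids — the "simplex exchange lemma" of Brunetti–Del Lungo–Gérard

Pure combinatorics of finite point sets `P ⊆ ℕ³` (a `Finset (ℕ × ℕ × ℕ)`) shared by the
NP-hardness proofs for positivity of Kronecker coefficients (Ikenmeyer–Mulmuley–Walter 2017,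
§2–§3) and of plethysm coefficients (Fischer–Ikenmeyer 2020, §5–§6), both of which go back to
the reduction of Brunetti–Del Lungo–Gérard 2001 (Thm. 3.1): a two-dimensional tomography
instance is embedded as the top layer of a discrete simplex, and a barycentre (coordinate-sum)
computation shows that every three-dimensional point set with the resulting plane sums is the
simplex plus a subset of that layer.

* `Tomography.xMarginal P i` (`yMarginal`, `zMarginal`) — the two-dimensional X-rays / plane sums
  `|{p ∈ P : p_x = i}|` (BDLG 2001, §2: `X_{S₁}F_i = |{P ∈ F | x_P = i}|`; IMW 2017, §2: "the
  `x`-marginal of `P`"; FI 2020, §6: `X_i(P)`);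
* `Tomography.csum p = x + y + z`, `Tomography.coordSum P = ∑_{p ∈ P} (x + y + z)` (FI 2020, §5:
  the coordinate sum `B(P)`; IMW 2017, §3 and BDLG 2001 use the barycentre `b_P · (1,1,1)`, the
  same number);
* `Tomography.simplex R = {p : x + y + z < R}` (BDLG 2001, proof of Thm. 3.1: the discrete
  3-simplex `P = {(i,j,k) : i + j + k < 2n}`; IMW 2017, §3: `P_R`; FI 2020, §7 (Thm. 5):
  `Q_{R-1}`) and `Tomography.layer R = {p : x + y + z = R}` (FI 2020, §6: the grid `G_R`, "in
  spirit two-dimensional", trilinear coordinates);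
* `Tomography.IsPyramid P` — down-sets for the coordinatewise order (Vallejo 2000 / IMW 2017, §2:
  "pyramid"; Manivel 1997: "3-partition", i.e. a plane partition); this is Mathlib's `IsLowerSet`
  of `↑P` for the product order on `ℕ × ℕ × ℕ`, kept under IMW's name with the unfolding
  `Tomography.isPyramid_iff`;
* **proved**: membership lemmas, `simplex (R+1) = simplex R ∪ layer R`, additivity of marginals,
  `#P = ∑ᵢ xMarginal P i`, the identity `coordSum P = ∑ i·xMarginal P i + ∑ j·yMarginal P j +
  ∑ k·zMarginal P k` ("the barycentre is purely a function of the marginals", IMW 2017, proof of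
  Lemma 3.1), the **exchange inequality** `coordSum (simplex R) + R·#P + #(simplex R \ P) ≤
  coordSum P + R·#(simplex R)` (`Tomography.exchange_le`) with its **equality case**
  `coordSum P + R·#(simplex R) = coordSum (simplex R) + R·#P ↔ simplex R ⊆ P ⊆ simplex (R+1)`
  (`Tomography.exchange_eq_iff`; this is IMW 2017 Lemma 3.1 / BDLG 2001, condition (1) in the
  proof of Thm. 3.1, in a subtraction-free form valid for all `P` and `R`; FI 2020 Lemma 6 is the
  analogue for point sets in the cone `x ≥ y ≥ z`),
  and `simplex R ⊆ P ⊆ simplex (R+1) → IsPyramid P` (IMW 2017, Lemma 3.1, "In particular, `P` is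
  a pyramid").

Design: everything is a `Finset` of `ℕ × ℕ × ℕ` and all statements avoid `ℕ`-subtraction; the
simplex is indexed so that `simplex R` has top layer `layer (R-1)` and `layer R` is the first
layer outside it (FI's `Q_{R-1}` / `G_R` convention shifted to avoid `R - 1`). Not here: the
cardinalities `#(simplex R) = R(R+1)(R+2)/6`, `#(layer R) = (R+1)(R+2)/2`, the cone versions
(`x ≥ y ≥ z`, FI 2020 §5, Lemmas 6–7) and anything about partitions or representation theory
(planned: `Literature/Computability/AlgebraicComplexity/KroneckerTomographyBounds.lean`).

## References

* [BrunettiDelLungoGerard2001] S. Brunetti, A. Del Lungo, Y. Gérard, *On the computational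
  complexity of reconstructing three-dimensional lattice sets from their two-dimensional X-rays*,
  Linear Algebra Appl. 339 (2001) 59–73, §2 and Thm. 3.1 (proof, condition (1)).
* [IkenmeyerMulmuleyWalter2017] C. Ikenmeyer, K. D. Mulmuley, M. Walter, *On vanishing of
  Kronecker coefficients*, Comput. Complexity 26 (2017) 949–992, §2 (marginals, pyramids),
  §3 (simplex `P_r`, `p(n)`, Lemma 3.1).
* [FischerIkenmeyer2020] N. Fischer, C. Ikenmeyer, *The computational complexity of plethysm
  coefficients*, Comput. Complexity 29 (2020) 8, §5 (coordinate sum `B(P)`, Prop. 2), §6 (grid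
  `G_r`, marginals `X_i(P)`; Lemmas 6–7, the cone analogues of the exchange lemma), §7 (`Q_r`).
-/

namespace Literature.Combinatorics.Enumerative

open Finset

namespace Tomography

/-! ### Points, marginals, coordinate sums -/

/-- A point of the non-negative octant of the integer lattice `ℤ³`, as a triple of naturals
`(x, y, z)`. [folklore] -/
abbrev Point3 : Type := ℕ × ℕ × ℕ

/-- The coordinate sum `x + y + z` of a point. [cite: FischerIkenmeyer2020, §5 (coordinate sum)] -/
def csum (p : Point3) : ℕ := p.1 + p.2.1 + p.2.2

/-- The `x`-marginal (plane sum orthogonal to the first axis): `xMarginal P i = |{p ∈ P : p_x = i}|`.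
[cite: BrunettiDelLungoGerard2001, §2] -/
def xMarginal (P : Finset Point3) (i : ℕ) : ℕ := (P.filter fun p => p.1 = i).card

/-- The `y`-marginal `|{p ∈ P : p_y = j}|`. [cite: BrunettiDelLungoGerard2001, §2] -/
def yMarginal (P : Finset Point3) (j : ℕ) : ℕ := (P.filter fun p => p.2.1 = j).card

/-- The `z`-marginal `|{p ∈ P : p_z = k}|`. [cite: BrunettiDelLungoGerard2001, §2] -/
def zMarginal (P : Finset Point3) (k : ℕ) : ℕ := (P.filter fun p => p.2.2 = k).card

/-- The coordinate sum of a point set, `B(P) = ∑_{p ∈ P} (x + y + z)` (three times the height of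
the barycentre along the diagonal, times `|P|`). [cite: FischerIkenmeyer2020, §5 (B(P))] -/
def coordSum (P : Finset Point3) : ℕ := ∑ p ∈ P, csum p

/-- Unfolding of `xMarginal`. [folklore] -/
theorem xMarginal_def (P : Finset Point3) (i : ℕ) :
    xMarginal P i = (P.filter fun p => p.1 = i).card := rfl

/-- Unfolding of `yMarginal`. [folklore] -/
theorem yMarginal_def (P : Finset Point3) (j : ℕ) :
    yMarginal P j = (P.filter fun p => p.2.1 = j).card := rfl

/-- Unfolding of `zMarginal`. [folklore] -/
theorem zMarginal_def (P : Finset Point3) (k : ℕ) :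
    zMarginal P k = (P.filter fun p => p.2.2 = k).card := rfl

/-- Marginals are additive over disjoint unions (`x`). [folklore] -/
theorem xMarginal_union {A B : Finset Point3} (h : Disjoint A B) (i : ℕ) :
    xMarginal (A ∪ B) i = xMarginal A i + xMarginal B i := by
  unfold xMarginal
  rw [filter_union, card_union_of_disjoint (disjoint_filter_filter h)]

/-- Marginals are additive over disjoint unions (`y`). [folklore] -/
theorem yMarginal_union {A B : Finset Point3} (h : Disjoint A B) (j : ℕ) :
    yMarginal (A ∪ B) j = yMarginal A j + yMarginal B j := by
  unfold yMarginal
  rw [filter_union, card_union_of_disjoint (disjoint_filter_filter h)]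

/-- Marginals are additive over disjoint unions (`z`). [folklore] -/
theorem zMarginal_union {A B : Finset Point3} (h : Disjoint A B) (k : ℕ) :
    zMarginal (A ∪ B) k = zMarginal A k + zMarginal B k := by
  unfold zMarginal
  rw [filter_union, card_union_of_disjoint (disjoint_filter_filter h)]

/-- For `B ⊆ A` the marginals of `A \ B` and `B` add up to those of `A` (`x`). [folklore] -/
theorem xMarginal_sdiff_add {A B : Finset Point3} (h : B ⊆ A) (i : ℕ) :
    xMarginal (A \ B) i + xMarginal B i = xMarginal A i := by
  rw [← xMarginal_union sdiff_disjoint, sdiff_union_of_subset h]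

/-- For `B ⊆ A` the marginals of `A \ B` and `B` add up to those of `A` (`y`). [folklore] -/
theorem yMarginal_sdiff_add {A B : Finset Point3} (h : B ⊆ A) (j : ℕ) :
    yMarginal (A \ B) j + yMarginal B j = yMarginal A j := by
  rw [← yMarginal_union sdiff_disjoint, sdiff_union_of_subset h]

/-- For `B ⊆ A` the marginals of `A \ B` and `B` add up to those of `A` (`z`). [folklore] -/
theorem zMarginal_sdiff_add {A B : Finset Point3} (h : B ⊆ A) (k : ℕ) :
    zMarginal (A \ B) k + zMarginal B k = zMarginal A k := by
  rw [← zMarginal_union sdiff_disjoint, sdiff_union_of_subset h]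

/-- The cardinality is the total of the `x`-marginal ("the sum of the coordinates of each X-ray is
equal to the cardinality", BDLG 2001, Remark 2.1 (2)). [cite: BrunettiDelLungoGerard2001, Remark 2.1] -/
theorem card_eq_sum_xMarginal {P : Finset Point3} {N : ℕ} (hN : ∀ p ∈ P, p.1 < N) :
    P.card = ∑ i ∈ range N, xMarginal P i := by
  unfold xMarginal
  exact card_eq_sum_card_fiberwise (f := fun p : Point3 => p.1) fun p hp => mem_range.2 (hN p hp)

/-- The cardinality is the total of the `y`-marginal. [cite: BrunettiDelLungoGerard2001, Remark 2.1] -/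
theorem card_eq_sum_yMarginal {P : Finset Point3} {N : ℕ} (hN : ∀ p ∈ P, p.2.1 < N) :
    P.card = ∑ j ∈ range N, yMarginal P j := by
  unfold yMarginal
  exact card_eq_sum_card_fiberwise (f := fun p : Point3 => p.2.1) fun p hp => mem_range.2 (hN p hp)

/-- The cardinality is the total of the `z`-marginal. [cite: BrunettiDelLungoGerard2001, Remark 2.1] -/
theorem card_eq_sum_zMarginal {P : Finset Point3} {N : ℕ} (hN : ∀ p ∈ P, p.2.2 < N) :
    P.card = ∑ k ∈ range N, zMarginal P k := by
  unfold zMarginal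
  exact card_eq_sum_card_fiberwise (f := fun p : Point3 => p.2.2) fun p hp => mem_range.2 (hN p hp)

/-- The sum of the first coordinates is `∑ i, i · xMarginal P i`. [folklore] -/
theorem sum_fst_eq_sum_mul_xMarginal {P : Finset Point3} {N : ℕ} (hN : ∀ p ∈ P, p.1 < N) :
    ∑ p ∈ P, p.1 = ∑ i ∈ range N, i * xMarginal P i := by
  have h := sum_fiberwise_of_maps_to' (s := P) (t := range N) (g := fun p : Point3 => p.1)
    (fun p hp => mem_range.2 (hN p hp)) (fun i : ℕ => i)
  rw [← h]
  refine sum_congr rfl fun i _ => ?_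
  rw [sum_const, xMarginal_def]; simp only [smul_eq_mul]; ring

/-- The sum of the second coordinates is `∑ j, j · yMarginal P j`. [folklore] -/
theorem sum_snd_eq_sum_mul_yMarginal {P : Finset Point3} {N : ℕ} (hN : ∀ p ∈ P, p.2.1 < N) :
    ∑ p ∈ P, p.2.1 = ∑ j ∈ range N, j * yMarginal P j := by
  have h := sum_fiberwise_of_maps_to' (s := P) (t := range N) (g := fun p : Point3 => p.2.1)
    (fun p hp => mem_range.2 (hN p hp)) (fun j : ℕ => j)
  rw [← h]
  refine sum_congr rfl fun j _ => ?_
  rw [sum_const, yMarginal_def]; simp only [smul_eq_mul]; ring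

/-- The sum of the third coordinates is `∑ k, k · zMarginal P k`. [folklore] -/
theorem sum_thd_eq_sum_mul_zMarginal {P : Finset Point3} {N : ℕ} (hN : ∀ p ∈ P, p.2.2 < N) :
    ∑ p ∈ P, p.2.2 = ∑ k ∈ range N, k * zMarginal P k := by
  have h := sum_fiberwise_of_maps_to' (s := P) (t := range N) (g := fun p : Point3 => p.2.2)
    (fun p hp => mem_range.2 (hN p hp)) (fun k : ℕ => k)
  rw [← h]
  refine sum_congr rfl fun k _ => ?_
  rw [sum_const, zMarginal_def]; simp only [smul_eq_mul]; ring

/-- **The coordinate sum is a function of the marginals**: `B(P) = ∑ i·x_P(i) + ∑ j·y_P(j) +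
∑ k·z_P(k)` ("the barycenter is purely a function of the marginals", IMW 2017, proof of
Lemma 3.1; BDLG 2001, proof of Thm. 3.1, the coordinates of `G_F`). Any bound `N` on the
coordinates may be used for the index ranges. [cite: IkenmeyerMulmuleyWalter2017, Lemma 3.1 (proof)] -/
theorem coordSum_eq_sum_marginals {P : Finset Point3} {N : ℕ}
    (hN : ∀ p ∈ P, p.1 < N ∧ p.2.1 < N ∧ p.2.2 < N) :
    coordSum P = ∑ i ∈ range N, i * xMarginal P i + ∑ j ∈ range N, j * yMarginal P j +
      ∑ k ∈ range N, k * zMarginal P k := by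
  unfold coordSum csum
  rw [sum_add_distrib, sum_add_distrib,
    sum_fst_eq_sum_mul_xMarginal (fun p hp => (hN p hp).1),
    sum_snd_eq_sum_mul_yMarginal (fun p hp => (hN p hp).2.1),
    sum_thd_eq_sum_mul_zMarginal (fun p hp => (hN p hp).2.2)]

/-- Two point sets with the same three marginals have the same coordinate sum.
[cite: BrunettiDelLungoGerard2001, Thm. 3.1 (proof: G_F = G_A)] -/
theorem coordSum_eq_of_marginals_eq {P P' : Finset Point3}
    (hx : ∀ i, xMarginal P i = xMarginal P' i) (hy : ∀ j, yMarginal P j = yMarginal P' j)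
    (hz : ∀ k, zMarginal P k = zMarginal P' k) : coordSum P = coordSum P' := by
  -- a common bound on all coordinates of both sets
  obtain ⟨N, hN⟩ : ∃ N, ∀ p ∈ P ∪ P', p.1 < N ∧ p.2.1 < N ∧ p.2.2 < N := by
    refine ⟨(P ∪ P').sup csum + 1, fun p hp => ?_⟩
    have h : csum p ≤ (P ∪ P').sup csum := le_sup (f := csum) hp
    have h' : p.1 + p.2.1 + p.2.2 ≤ (P ∪ P').sup csum := h
    refine ⟨?_, ?_, ?_⟩ <;> omega
  rw [coordSum_eq_sum_marginals (N := N) (fun p hp => hN p (mem_union_left _ hp)),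
    coordSum_eq_sum_marginals (N := N) (fun p hp => hN p (mem_union_right _ hp))]
  simp only [hx, hy, hz]

/-- The coordinate sum is additive over disjoint unions. [folklore] -/
theorem coordSum_union {A B : Finset Point3} (h : Disjoint A B) :
    coordSum (A ∪ B) = coordSum A + coordSum B := by
  unfold coordSum
  exact sum_union h

/-! ### Discrete simplices and layers -/

/-- The discrete simplex of side `R`: `simplex R = {(x,y,z) ∈ ℕ³ : x + y + z < R}` (as a finite
set; `|simplex R| = R(R+1)(R+2)/6`). BDLG 2001 (proof of Thm. 3.1): `P = {(i,j,k) ∈ {0,…,2n}³ |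
i + j + k < 2n}`; IMW 2017 §3: `P_r`; FI 2020 §7: `Q_{R-1}`. [cite: BrunettiDelLungoGerard2001, Thm. 3.1 (proof)] -/
def simplex (R : ℕ) : Finset Point3 :=
  (range R ×ˢ range R ×ˢ range R).filter fun p => csum p < R

/-- The layer `layer R = {(x,y,z) ∈ ℕ³ : x + y + z = R}` (FI 2020 §6: the triangular grid `G_R`
in trilinear coordinates; BDLG 2001: "the plane `x + y + z = 2n`").
[cite: FischerIkenmeyer2020, §6 (G_r)] -/
def layer (R : ℕ) : Finset Point3 :=
  (range (R + 1) ×ˢ range (R + 1) ×ˢ range (R + 1)).filter fun p => csum p = R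

/-- Membership in the simplex is `x + y + z < R`. [folklore] -/
@[simp] theorem mem_simplex {R : ℕ} {p : Point3} : p ∈ simplex R ↔ csum p < R := by
  unfold simplex csum
  simp only [mem_filter, mem_product, mem_range]
  constructor
  · exact fun h => h.2
  · intro h
    exact ⟨⟨by omega, by omega, by omega⟩, h⟩

/-- Membership in the layer is `x + y + z = R`. [folklore] -/
@[simp] theorem mem_layer {R : ℕ} {p : Point3} : p ∈ layer R ↔ csum p = R := by
  unfold layer csum
  simp only [mem_filter, mem_product, mem_range]
  constructor
  · exact fun h => h.2
  · intro h
    exact ⟨⟨by omega, by omega, by omega⟩, h⟩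

/-- `simplex 0 = ∅`. [folklore] -/
@[simp] theorem simplex_zero : simplex 0 = ∅ := by
  ext p; simp

/-- The next simplex is the simplex plus the next layer. [folklore] -/
theorem simplex_succ (R : ℕ) : simplex (R + 1) = simplex R ∪ layer R := by
  ext p
  simp only [mem_simplex, mem_union, mem_layer]
  omega

/-- The simplex and the next layer are disjoint. [folklore] -/
theorem disjoint_simplex_layer (R : ℕ) : Disjoint (simplex R) (layer R) := by
  rw [disjoint_left]
  intro p hp hq
  rw [mem_simplex] at hp
  rw [mem_layer] at hq
  omega

/-- Simplices are nested. [folklore] -/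
theorem simplex_subset_succ (R : ℕ) : simplex R ⊆ simplex (R + 1) := by
  intro p hp
  rw [mem_simplex] at hp ⊢
  omega

/-- The layer lies in the next simplex. [folklore] -/
theorem layer_subset_simplex_succ (R : ℕ) : layer R ⊆ simplex (R + 1) := by
  intro p hp
  rw [mem_layer] at hp
  rw [mem_simplex]
  omega

/-- A set between `simplex R` and `simplex (R+1)` is `simplex R` plus a part of `layer R`
(BDLG 2001, proof of Thm. 3.1: "the set `F` is the union of `P` with a set `H`" in the plane
`x + y + z = 2n`). [cite: BrunettiDelLungoGerard2001, Thm. 3.1 (proof)] -/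
theorem sdiff_subset_layer {P : Finset Point3} {R : ℕ} (h₂ : P ⊆ simplex (R + 1)) :
    P \ simplex R ⊆ layer R := by
  intro p hp
  rw [mem_sdiff, mem_simplex] at hp
  have h := mem_simplex.1 (h₂ hp.1)
  rw [mem_layer]
  omega

/-- Conversely `simplex R ∪ S` for `S ⊆ layer R` lies between the two simplices. [folklore] -/
theorem simplex_union_subset {S : Finset Point3} {R : ℕ} (hS : S ⊆ layer R) :
    simplex R ⊆ simplex R ∪ S ∧ simplex R ∪ S ⊆ simplex (R + 1) :=
  ⟨subset_union_left, union_subset (simplex_subset_succ R)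
    (hS.trans (layer_subset_simplex_succ R))⟩

/-- The coordinates of points of `simplex R` are `< R` (and so are usable as the bound `N` in
`coordSum_eq_sum_marginals`). [folklore] -/
theorem lt_of_mem_simplex {R : ℕ} {p : Point3} (h : p ∈ simplex R) :
    p.1 < R ∧ p.2.1 < R ∧ p.2.2 < R := by
  rw [mem_simplex] at h
  unfold csum at h
  exact ⟨by omega, by omega, by omega⟩

/-! ### Pyramids -/

/-- A *pyramid* (plane partition / 3-partition): a point set closed downwards for the
coordinatewise order, i.e. `(x,y,z) ∈ P`, `x' ≤ x`, `y' ≤ y`, `z' ≤ z` imply `(x',y',z') ∈ P`.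
[cite: IkenmeyerMulmuleyWalter2017, §2 (pyramid)] -/
def IsPyramid (P : Finset Point3) : Prop :=
  IsLowerSet (↑P : Set Point3)

/-- Unfolding of `IsPyramid` (Mathlib's `IsLowerSet` for the product order) into the printed
coordinatewise condition. [cite: IkenmeyerMulmuleyWalter2017, §2 (pyramid)] -/
theorem isPyramid_iff (P : Finset Point3) :
    IsPyramid P ↔
      ∀ ⦃p : Point3⦄, p ∈ P → ∀ ⦃q : Point3⦄, q.1 ≤ p.1 → q.2.1 ≤ p.2.1 → q.2.2 ≤ p.2.2 →
        q ∈ P := by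
  unfold IsPyramid IsLowerSet
  constructor
  · intro h p hp q h1 h2 h3
    exact Finset.mem_coe.1 (h (Prod.le_def.2 ⟨h1, Prod.le_def.2 ⟨h2, h3⟩⟩) (Finset.mem_coe.2 hp))
  · intro h a b hba ha
    have h' := Prod.le_def.1 hba
    have h'' := Prod.le_def.1 h'.2
    exact Finset.mem_coe.2 (h (Finset.mem_coe.1 ha) h'.1 h''.1 h''.2)

/-- The simplex is a pyramid. [folklore] -/
theorem isPyramid_simplex (R : ℕ) : IsPyramid (simplex R) := by
  rw [isPyramid_iff]
  intro p hp q h1 h2 h3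
  rw [mem_simplex] at hp ⊢
  unfold csum at hp ⊢
  omega

/-- **Sets sandwiched between consecutive simplices are pyramids** (IMW 2017, Lemma 3.1: "In
particular, `P` is a pyramid"; cone analogue: FI 2020, Prop. 2).
[cite: IkenmeyerMulmuleyWalter2017, Lemma 3.1] -/
theorem isPyramid_of_simplex_subset {P : Finset Point3} {R : ℕ} (h₁ : simplex R ⊆ P)
    (h₂ : P ⊆ simplex (R + 1)) : IsPyramid P := by
  rw [isPyramid_iff]
  intro p hp q hq1 hq2 hq3
  by_cases hqp : q = p
  · rw [hqp]; exact hp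
  · apply h₁
    have hpR := mem_simplex.1 (h₂ hp)
    rw [mem_simplex]
    have hne : ¬ (q.1 = p.1 ∧ q.2.1 = p.2.1 ∧ q.2.2 = p.2.2) :=
      fun hcon => hqp (Prod.ext hcon.1 (Prod.ext hcon.2.1 hcon.2.2))
    unfold csum at hpR ⊢
    omega

/-! ### The exchange inequality and its equality case -/

/-- Points outside `simplex R` have coordinate sum `≥ R`, so `R · |P \ simplex R| ≤ B(P \ simplex R)`
(one half of the barycentre comparison of BDLG 2001, proof of Thm. 3.1; cone analogue: FI 2020,
Lemma 6). [cite: BrunettiDelLungoGerard2001, Thm. 3.1 (proof)] -/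
theorem mul_card_sdiff_le_coordSum (P : Finset Point3) (R : ℕ) :
    R * (P \ simplex R).card ≤ coordSum (P \ simplex R) := by
  unfold coordSum
  have h := card_nsmul_le_sum (P \ simplex R) csum R (fun p hp => by
    rw [mem_sdiff, mem_simplex] at hp
    omega)
  simpa only [smul_eq_mul, mul_comm] using h

/-- Points of `simplex R` have coordinate sum `≤ R - 1`, so `B(S) + |S| ≤ R · |S|` for
`S ⊆ simplex R` (the other half; cone analogue: FI 2020, Lemma 6).
[cite: BrunettiDelLungoGerard2001, Thm. 3.1 (proof)] -/
theorem coordSum_add_card_le {S : Finset Point3} {R : ℕ} (hS : S ⊆ simplex R) :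
    coordSum S + S.card ≤ R * S.card := by
  unfold coordSum
  have h1 : ∑ p ∈ S, csum p + S.card = ∑ p ∈ S, (csum p + 1) := by
    rw [sum_add_distrib, sum_const]; simp only [smul_eq_mul, mul_one]
  rw [h1]
  have h := sum_le_card_nsmul S (fun p => csum p + 1) R (fun p hp => by
    have := mem_simplex.1 (hS hp)
    omega)
  simpa only [smul_eq_mul, mul_comm] using h

/-- **The exchange inequality** (the barycentre of an `n`-point set is lowest for the sets
sandwiched between consecutive simplices; BDLG 2001, proof of Thm. 3.1; IMW 2017, Lemma 3.1;
cone analogues: FI 2020, Lemmas 2 and 6), in the subtraction-free form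
`B(Q) + R·|P| + |Q \ P| ≤ B(P) + R·|Q|` for `Q = simplex R`, valid for every finite `P` and
every `R`. [cite: IkenmeyerMulmuleyWalter2017, Lemma 3.1] -/
theorem exchange_le (P : Finset Point3) (R : ℕ) :
    coordSum (simplex R) + R * P.card + (simplex R \ P).card ≤
      coordSum P + R * (simplex R).card := by
  -- decompositions of `P` and `Q = simplex R` along `P ∩ Q`
  have hP : coordSum P = coordSum (P \ simplex R) + coordSum (P ∩ simplex R) := by
    rw [← coordSum_union (disjoint_sdiff_inter P (simplex R)), sdiff_union_inter]
  have hQ : coordSum (simplex R) = coordSum (simplex R \ P) + coordSum (P ∩ simplex R) := by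
    rw [inter_comm, ← coordSum_union (disjoint_sdiff_inter (simplex R) P), sdiff_union_inter]
  have hcP : (P \ simplex R).card + (P ∩ simplex R).card = P.card :=
    card_sdiff_add_card_inter P (simplex R)
  have hcQ : (simplex R \ P).card + (P ∩ simplex R).card = (simplex R).card := by
    rw [inter_comm]; exact card_sdiff_add_card_inter (simplex R) P
  have h1 : R * (P \ simplex R).card ≤ coordSum (P \ simplex R) := mul_card_sdiff_le_coordSum P R
  have h2 : coordSum (simplex R \ P) + (simplex R \ P).card ≤ R * (simplex R \ P).card :=
    coordSum_add_card_le sdiff_subset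
  have e1 : R * P.card = R * (P \ simplex R).card + R * (P ∩ simplex R).card := by
    rw [← hcP, mul_add]
  have e2 : R * (simplex R).card = R * (simplex R \ P).card + R * (P ∩ simplex R).card := by
    rw [← hcQ, mul_add]
  omega

/-- **Equality case of the exchange inequality** (IMW 2017, Lemma 3.1: the barycentre height
attains the minimum `p(n)` "if and only if `P_r ⊆ P ⊊ P_{r+1}`"; BDLG 2001, condition (1);
cone analogue: FI 2020, Lemma 6): `B(P) + R·|simplex R| = B(simplex R) + R·|P|` holds iff
`simplex R ⊆ P ⊆ simplex (R+1)`. [cite: IkenmeyerMulmuleyWalter2017, Lemma 3.1] -/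
theorem exchange_eq_iff (P : Finset Point3) (R : ℕ) :
    coordSum P + R * (simplex R).card = coordSum (simplex R) + R * P.card ↔
      simplex R ⊆ P ∧ P ⊆ simplex (R + 1) := by
  constructor
  · intro heq
    have hle := exchange_le P R
    -- first consequence: `simplex R ⊆ P`
    have hsub : simplex R ⊆ P := by
      have h0 : (simplex R \ P).card = 0 := by omega
      exact sdiff_eq_empty_iff_subset.1 (card_eq_zero.1 h0)
    refine ⟨hsub, ?_⟩
    -- with `simplex R ⊆ P` the equation says `B(P \ simplex R) = R · |P \ Q|`
    have hP : coordSum P = coordSum (P \ simplex R) + coordSum (simplex R) := by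
      rw [← coordSum_union sdiff_disjoint, sdiff_union_of_subset hsub]
    have hc : (P \ simplex R).card + (simplex R).card = P.card := card_sdiff_add_card_eq_card hsub
    have hsum : coordSum (P \ simplex R) = R * (P \ simplex R).card := by
      have h1 := mul_card_sdiff_le_coordSum P R
      have e : R * P.card = R * (P \ simplex R).card + R * (simplex R).card := by rw [← hc, mul_add]
      omega
    -- hence every point of `P \ Q` has coordinate sum exactly `R`
    have hge : ∀ p ∈ P \ simplex R, R ≤ csum p := fun p hp => by
      rw [mem_sdiff, mem_simplex] at hp; omega
    have hall : ∀ p ∈ P \ simplex R, csum p = R := by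
      intro p₀ hp₀
      by_contra hne
      have hlt : ∑ p ∈ P \ simplex R, R < ∑ p ∈ P \ simplex R, csum p :=
        sum_lt_sum hge ⟨p₀, hp₀, lt_of_le_of_ne (hge p₀ hp₀) (Ne.symm hne)⟩
      rw [sum_const] at hlt
      simp only [smul_eq_mul] at hlt
      unfold coordSum at hsum
      rw [hsum, mul_comm] at hlt
      exact lt_irrefl _ hlt
    intro p hp
    rw [mem_simplex]
    by_cases hpQ : p ∈ simplex R
    · have := mem_simplex.1 hpQ; omega
    · have := hall p (mem_sdiff.2 ⟨hp, hpQ⟩); omega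
  · rintro ⟨h₁, h₂⟩
    have hP : coordSum P = coordSum (P \ simplex R) + coordSum (simplex R) := by
      rw [← coordSum_union sdiff_disjoint, sdiff_union_of_subset h₁]
    have hc : (P \ simplex R).card + (simplex R).card = P.card := card_sdiff_add_card_eq_card h₁
    have hsum : coordSum (P \ simplex R) = R * (P \ simplex R).card := by
      unfold coordSum
      rw [mul_comm, sum_const_nat (m := R) fun p hp => mem_layer.1 (sdiff_subset_layer h₂ hp)]
    have e : R * P.card = R * (P \ simplex R).card + R * (simplex R).card := by rw [← hc, mul_add]
    omega

/-- The equality case in the form used by the reductions: if `|P| = |simplex R| + m` and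
`B(P) = B(simplex R) + R · m` then `simplex R ⊆ P ⊆ simplex (R+1)` (BDLG 2001, proof of
Thm. 3.1: `G_F = G_A` forces condition (1); cone analogue: FI 2020, Lemma 7).
[cite: BrunettiDelLungoGerard2001, Thm. 3.1 (proof)] -/
theorem simplex_subset_of_card_of_coordSum {P : Finset Point3} {R m : ℕ}
    (hcard : P.card = (simplex R).card + m) (hsum : coordSum P = coordSum (simplex R) + R * m) :
    simplex R ⊆ P ∧ P ⊆ simplex (R + 1) := by
  refine (exchange_eq_iff P R).1 ?_
  rw [hsum, hcard, mul_add]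
  ring

/-- … and conversely such sandwiched sets have exactly this cardinality and coordinate sum, with
`m = |P \ simplex R|` (cone analogue: FI 2020, Lemma 7). [cite: BrunettiDelLungoGerard2001, Thm. 3.1 (proof)] -/
theorem card_coordSum_of_simplex_subset {P : Finset Point3} {R : ℕ} (h₁ : simplex R ⊆ P)
    (h₂ : P ⊆ simplex (R + 1)) :
    P.card = (simplex R).card + (P \ simplex R).card ∧
      coordSum P = coordSum (simplex R) + R * (P \ simplex R).card := by
  have hc : (P \ simplex R).card + (simplex R).card = P.card := card_sdiff_add_card_eq_card h₁
  have hP : coordSum P = coordSum (P \ simplex R) + coordSum (simplex R) := by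
    rw [← coordSum_union sdiff_disjoint, sdiff_union_of_subset h₁]
  have hsum : coordSum (P \ simplex R) = R * (P \ simplex R).card := by
    unfold coordSum
    rw [mul_comm, sum_const_nat (m := R) fun p hp => mem_layer.1 (sdiff_subset_layer h₂ hp)]
  constructor <;> omega

/-- **The top layer of a sandwiched set carries the difference of the marginals**: if
`simplex R ⊆ P ⊆ simplex (R+1)` then `S = P \ simplex R ⊆ layer R` and the marginals of `P` are
those of `simplex R` plus those of `S` (BDLG 2001, proof of Thm. 3.1: "the set `F` is the union of
`P` with a set `H`"; cone analogue: FI 2020, Lemma 7). [cite: BrunettiDelLungoGerard2001, Thm. 3.1 (proof)] -/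
theorem marginals_of_simplex_subset {P : Finset Point3} {R : ℕ} (h₁ : simplex R ⊆ P)
    (h₂ : P ⊆ simplex (R + 1)) :
    P \ simplex R ⊆ layer R ∧
      (∀ i, xMarginal P i = xMarginal (simplex R) i + xMarginal (P \ simplex R) i) ∧
      (∀ j, yMarginal P j = yMarginal (simplex R) j + yMarginal (P \ simplex R) j) ∧
      (∀ k, zMarginal P k = zMarginal (simplex R) k + zMarginal (P \ simplex R) k) := by
  refine ⟨sdiff_subset_layer h₂, fun i => ?_, fun j => ?_, fun k => ?_⟩
  · rw [← xMarginal_sdiff_add h₁ i, add_comm]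
  · rw [← yMarginal_sdiff_add h₁ j, add_comm]
  · rw [← zMarginal_sdiff_add h₁ k, add_comm]

end Tomography

end Literature.Combinatorics.Enumerative
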